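import Summits.BirchSwinnertonDyer.BirchSwinnertonDyer.Theorems.PrintX9HowardIMCLink
import Summits.BirchSwinnertonDyer.Rank1Residual.X11b.Three.KolyvaginLine
import Summits.BirchSwinnertonDyer.Rank1Residual.X11b.BDPRouteRankOneBookkeeping
import Summits.BirchSwinnertonDyer.Rank1Residual.X11b.KolyvaginBottomPoint
import Literature.NumberTheory.EllipticCurves.HeegnerPointsKolyvaginPrimaryGeneratorProofs
import Literature.NumberTheory.EllipticCurves.Cha2005.ShaStructureIrreducible
import Literature.NumberTheory.EllipticCurves.BSDSelmerCMPConverseHeegnerFieldProofs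
import Literature.NumberTheory.EllipticCurves.HeegnerPointsClassesProofs
import Literature.NumberTheory.EllipticCurves.HeegnerPointsRationalityProofs
import HarnessLib

/-!
# Crux `MultiPrimeX9` (stmt-BirchSwinnertonDyer-22889) on the HOWARD FRAMES: the «`M_∞ ≥ ord_p ∏ c_q`»
# half of the refined Kolyvagin conjecture at IRREDUCIBLE NON-SURJECTIVE image, on every X9 Heegner
# frame with `d_K` odd and `p ∤ h_K`, from the Heegner-index IDENTITY over `K` (Howard road) and the
# LOWER half of Kolyvagin's structure theorem under irreducibility (Cha 2005 Rmk. 25, certificate form)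
# — registered stub `stub_multiPrime_oddCoprimeFrames`, modulo named facts
# (cell `bsd-print-x9`, prover seat p4 «Heegner/Kolyvagin road under irreducibility», gen 3)

HONEST FRAMING (cell `run/shared/lean/pub/bsd-print-x9/`, D-0131 print tier): THEOREMS ONLY (no
definition, no named fact, no `sorry`); every published theorem enters as a named Literature fact BY
NAME; nothing is asserted about any curve; the crux `MultiPrimeX9` is NOT closed (its second registered
stub, the frames with `d_K` even or `p ∣ h_K`, has no known mechanism at any image).

## The argument (BCGS 2026 Thm. 2's a-posteriori road, read at the X9 image)

Fix an X9 pair `(E, p)`, a Heegner field `K` with `p` split, `|d_K| > 4`, `d_K` odd, `p ∤ h_K`, a frame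
`(Dt, β, ι)` with `p ∤ c(Dt)`, a conductor-`1` datum `d₁` with `P_1 = y_K` of infinite order, a depth
`s ≤ t = ord_p ∏ c_ℓ(E)` and a Kolyvagin–Heegner datum `d` of square-free conductor `n` all of whose
prime factors are Kolyvagin primes of index `≥ s`. Suppose `P_n ∉ p^s E(K_n)`, `s ≥ 1`. Then `(n, d)` is
a level-`s` certificate and Cha's lower half gives `p^{2(M₀ − (s−1))} ∣ #Ш(E/K)[p^∞]`, `p^{M₀} ∥ y_K` in
`E(K)` (`M₀ = ord_p[E(K):ℤy_K]`, McCallum Lemma 5.1 in the kernel). The Howard road gives the IDENTITY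
`ord_p #Ш(E/K) + 2t = 2 M₀` at this frame (`X9.indexIdentityAt_of_heegnerPoint_of_cor46_of_thm331`, §1:
MZ26 Cor. 4.6 ∘ Yan–Zhu 5.7 (1)/5.9 + BCS 4.2.2 + CGLS 5.1.3 ∘ JSW 3.3.1, intrinsic over `K`). So
`2M₀ − 2s + 2 ≤ 2M₀ − 2t ≤ 2M₀ − 2s` — absurd. Hence `P_n ∈ p^s E(K_n)`: Heegner points ARE
`p^s`-divisible to the FULL Tamagawa depth on these frames, for ANY distribution of the depth among the
bad primes (single- or multi-carrier), with NO use of Jetchev's induction and NO Kolyvagin conjecture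
(`y_K` has infinite order). «beyond-print theorem»: YES — BCGS 2026 Thm. 2 prints `𝓜_∞ = Σ ord_p c_ℓ`
only under (sur) ∧ `p > 3`; here the `≥` half holds at irreducible NON-surjective image (class X9,
`p ∈ {5, 7}`) on the Howard frames, modulo the named facts {MZ26 Cor. 4.6, the YZ/BCS/CGLS composite,
JSW 3.3.1, Cha 2005 Rmk. 25 (lower half), Kolyvagin 1990 Thm. A, Shimura reciprocity at conductor 1}.

## Contents

* §1 `X9.indexIdentityAt_of_heegnerPoint_of_cor46_of_thm331` — the identity over `K`, INTRINSIC form: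
  hypotheses on `K` and the Heegner point `P` only (`P` non-torsion), rank one and finiteness over `K`
  from Kolyvagin (`hKo`); no `r_an(E) = 1`, no `L(E^K,1) ≠ 0` (so it serves the frames of the rank-0
  members too, where the twist carries the rank).
* §2 `multiPrime_oddCoprimeFrames_of_namedFacts` — the registered stub
  `stub_multiPrime_oddCoprimeFrames` of crux 22889 VERBATIM (bound `B = 4`), from the named facts.

References: [BurungaleEtAl2026] Thm. 2 (arXiv:2312.09301 p. 4); [Cha2005] Thm. 21, Rmk. 25;
[MatarNekovar2019] Thm. 0.7, §0.9, §0.11; [McCallumLMS1991] §5 Lemma 5.1, Cor. 5.6;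
[MastellaZerman2026] Cor. 4.6; [YanZhu2024MainConjNonCM] Thm. 5.7 (1), 5.9; [BurungaleCastellaSkinner2025]
Prop. 4.2.2; [CastellaGrossiLeeSkinner2022] Thm. 5.1.3; [JetchevSkinnerWan2017] Thm. 3.3.1;
[Jetchev2008] Conj. 1.3, Thm. 1.4; [GrossLMS1991] §4; [Darmon2004] Thm. 3.7.
-/

set_option linter.dupNamespace false
set_option autoImplicit false

noncomputable section

open scoped Classical MatrixGroups ModularForm

open CongruenceSubgroup WeierstrassCurve NumberField IsDedekindDomain
  Literature.NumberTheory.EllipticCurves Literature.NumberTheory.EllipticCurves.ModularForms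
  Literature.NumberTheory.EllipticCurves.JetchevSkinnerWan2017
  Literature.NumberTheory.EllipticCurves.YanZhu2026
  Summit.BirchSwinnertonDyer.BirchSwinnertonDyer.Theorems.Rank1ResidualX1Defs
  Summit.BirchSwinnertonDyer.Rank1Residual
  Summit.BirchSwinnertonDyer.Rank1Residual.X11b.Three.Koly
  Summit.BirchSwinnertonDyer.Rank1Residual.X11b.KolyvaginBottom

namespace Summit.BirchSwinnertonDyer.BirchSwinnertonDyer.Rank1Residual

/-! ### §1 The Heegner-index identity over `K`, intrinsic form (non-torsion Heegner point) -/

/-- **The Heegner-index identity `2·ord_p ∏_ℓ c_ℓ(E) + ord_p #Ш(E/K) = 2·ord_p [E(K):ℤP_K]` at a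
Manin-unit Heegner datum of an X9 pair over a Heegner field with `p` split, `d_K` odd `< −4`, `p ∤ h_K`,
whose Heegner point `P = P_K` has INFINITE ORDER** — intrinsic over `K` (rank one and finiteness of
`Ш(E/K)` by Kolyvagin, `hKo`; no hypothesis on `r_an(E/ℚ)` or on the twist). Inputs as in
`X9.indexIdentityAt_of_heegner_of_cor46_of_thm331`: Mastella–Zerman Cor. 4.6 (`h46`), the composite
(`hYZ`), JSW 3.3.1 (`h331`); (irr_K) by the Matar–Nekovář theorem.
[cite: MastellaZerman2026, Cor. 4.6] [cite: YanZhu2024MainConjNonCM, Thm. 5.7 (1), Thm. 5.9]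
[cite: BurungaleCastellaSkinner2025, Prop. 4.2.2] [cite: CastellaGrossiLeeSkinner2022, Thm. 5.1.3]
[cite: JetchevSkinnerWan2017, Thm. 3.3.1, §7.3.1 (eq:tamK)] [cite: Kolyvagin1990, Thm. A]
[cite: GrossLMS1991, §2 Conj. (2.2)] -/
theorem X9.indexIdentityAt_of_heegnerPoint_of_cor46_of_thm331
    (h46 : MastellaZerman2026.cor46_howardDivisibility_of_scalarImage.{0})
    (hYZ : thm57_thm59_bcs422_cgls513_generator_constantCoeff_of_heegnerDivisibility)
    (h331 : thm331_anticyclotomicControl)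
    (W : WeierstrassCurve ℚ) [W.IsElliptic] [W.IsGloballyMinimal] [NeZero (W.conductorNorm ℤ)]
    (p : ℕ) [Fact p.Prime] (hX9 : Literature.NumberTheory.EllipticCurves.Rank1Residual.ClassX9 W p)
    (K : Type) [Field K] [NumberField K] (hKo : kolyvagin (W.conductorNorm ℤ) W K)
    (hK : IsImaginaryQuadratic K) (hodd : Odd (NumberField.discr K)) (hlt : NumberField.discr K < -4)
    (hHN : SatisfiesHeegnerHypothesis (W.conductorNorm ℤ) K) (hHp : SatisfiesHeegnerHypothesis p K)
    (hhK : ¬ p ∣ NumberField.classNumber K)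
    (Dt : ModularParametrizationData W (W.conductorNorm ℤ))
    (H : HeegnerDatum (W.conductorNorm ℤ) (NumberField.discr K)) (ιC : K →+* ℂ)
    (P : (W.baseChange K).toAffine.Point)
    (hP : WeierstrassCurve.Affine.Point.map ιC.toRatAlgHom P = heegnerPointComplex Dt H)
    (hPinf : ¬ IsOfFinAddOrder P) (hc : ¬ (p : ℤ) ∣ Dt.c) : X11b.IndexIdentityAt W p K P := by
  have hpP : p.Prime := Fact.out
  have hp2 : p ≠ 2 := hX9.ne_two
  have hp5 : 5 ≤ p := hX9.five_le
  have h3 : NumberField.discr K ≠ -3 := by omega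
  have h4 : NumberField.discr K ≠ -4 := by omega
  -- rank one and finiteness over `K` (Kolyvagin, from the non-torsion Heegner point)
  obtain ⟨hrk, hshaK⟩ := hKo hK hHN ⟨Dt, H, ιC, hP⟩ hPinf
  haveI : Finite (W.baseChange K).sha := hshaK
  have hfinp : Finite (AddCommGroup.primaryComponent (W.baseChange K).sha p) :=
    Finite.of_injective _ Subtype.val_injective
  -- (irr_K) at this field (Matar–Nekovář Prop. 5.26 (2), a tree theorem)
  have hirrK : (W.baseChange K).HasIrreducibleModPGaloisRep p :=
    MatarNekovar2019.prop526_hasIrreducibleModPGaloisRep_baseChange_holds W K hK.1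
      (Literature.SatisfiesHeegnerHypothesis.coprime_discr hK.1 hHN) p hp2 hX9.irr
  -- the anticyclotomic datum and the embedding at a prime above `p`
  obtain ⟨κ, γ, 𝔭, hκ, hγ, h𝔭⟩ := X11b.exists_anticyclotomic_generator_prime (p := p) hK
  haveI : Fact (κ.IsTopGenerator γ) := ⟨hγ⟩
  have hsplit : X11b.SplitsIn K p := hHp p Fact.out (dvd_refl p)
  obtain ⟨he, hf⟩ := X11b.degreeOne_of_splitsIn hK.1 hsplit h𝔭
  set ι : K →+* ℚ_[p] := X11b.embAt K p 𝔭 h𝔭 he hf with hι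
  have hCTL : X11b.ControlOnTreeGoodAt p κ (X11b.inducedPlace ι) γ ι P :=
    X11b.controlOnTreeGoodAt_of_thm331_of_inducedPlace h331 (by omega) hX9.good hK hHp rfl hHN hirrK ι
      κ hκ γ hrk hfinp P hPinf
  have hHow := X9.heegnerContainment_of_cor46 h46 hX9 hK h3 h4 hHN hHp hhK κ hκ γ hγ Dt H ιC
  have hIW : X11b.IMCWaldspurgerOnTreeGoodAt p κ (X11b.inducedPlace ι) γ ι P :=
    X11b.imcWaldspurgerOnTreeGoodAt_inducedPlace_of_heegnerContainment_of_thm331 hYZ h331 (by omega)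
      hX9.goodOrd hK hodd h3 rfl hHN hHp hirrK hhK ι κ hκ γ Dt hc H ιC P hP hrk hfinp hPinf hHow
  exact X11b.indexIdentityAt_of_onTreeGoodLinks_of_allSplit hK rfl hHN hIW hCTL

/-! ### §2 The registered stub `stub_multiPrime_oddCoprimeFrames` of crux 22889, from named facts -/

/-- **`MultiPrimeX9` on the Howard frames (`d_K` odd, `p ∤ h_K`) — registered stub
`stub_multiPrime_oddCoprimeFrames` of crux stmt-BirchSwinnertonDyer-22889 VERBATIM (bound `B = 4`), from
named facts:** on every such X9 frame every derived Heegner point `P_n` (square-free `n` of Kolyvagin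
primes of index `≥ s`) is `p^s`-divisible in `E(K_n)` for ALL `s ≤ ord_p ∏ c_ℓ(E)` — the «`M_∞ ≥ Σ_q
ord_p c_q`» half of the refined Kolyvagin conjecture (Jetchev 2008 Conj. 1.3; BCGS 2026 Thm. 2 under
(sur)) at IRREDUCIBLE NON-SURJECTIVE image. Proof: if `P_n ∉ p^s E(K_n)` with `s ≥ 1`, Cha's LOWER half
(`hChaL`, certificate at level `s`) gives `2(M₀ − (s − 1)) ≤ ord_p #Ш(E/K)` with `p^{M₀} ∥ y_K`, while the
identity of §1 gives `ord_p #Ш(E/K) = 2M₀ − 2t ≤ 2M₀ − 2s` — contradiction. Inputs BY NAME: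
Mastella–Zerman 2026 Cor. 4.6 (`h46`), the Yan–Zhu/BCS/CGLS composite (`hYZ`), JSW 2017 Thm. 3.3.1
(`h331`), Cha 2005 Rmk. 25 lower half (`hChaL`, flag `Cha05-Rmk25-structure`), Kolyvagin 1990 Thm. A
(`hKo`), Shimura reciprocity at conductor `1` (`hrec`); THEOREMS: `exists_heegnerDatum`,
`heegnerPointComplex_mem_range_map_holds` (the Heegner point `y_K ∈ E(K)` of the frame), Matar–Nekovář
5.26 (2), McCallum Lemma 5.1 in the kernel (`padicValNat_index_zmultiples_eq_of_divisibility`). The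
hypotheses `W.analyticRank ≤ 1` and the multi-carrier clause are NOT used (the theorem holds for every
Tamagawa distribution). NO Jetchev, NO Kolyvagin conjecture, NO (sur)/(im).
[cite: BurungaleEtAl2026, Thm. 2 (arXiv:2312.09301 p. 4, under (sur))] [cite: Jetchev2008, Conj. 1.3, Thm. 1.4]
[cite: Cha2005, Thm. 21 and Rmk. 25 (pp. 173–175)] [cite: MatarNekovar2019, Thm. 0.7, §0.9, §0.11]
[cite: McCallumLMS1991, §5 Lemma 5.1, Cor. 5.6] [cite: MastellaZerman2026, Cor. 4.6]
[cite: YanZhu2024MainConjNonCM, Thm. 5.7 (1), Thm. 5.9] [cite: JetchevSkinnerWan2017, Thm. 3.3.1] -/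
theorem multiPrime_oddCoprimeFrames_of_namedFacts
    (h46 : MastellaZerman2026.cor46_howardDivisibility_of_scalarImage.{0})
    (hYZ : thm57_thm59_bcs422_cgls513_generator_constantCoeff_of_heegnerDivisibility)
    (h331 : thm331_anticyclotomicControl)
    (hChaL : Cha2005.rmk25_pow_dvd_card_sha_primary_of_certificate)
    (hKo : ∀ (N : ℕ) [NeZero N] (W : WeierstrassCurve ℚ) (K : Type) [Field K] [NumberField K],
      kolyvagin N W K)
    (hrec : ∀ (N : ℕ) [NeZero N] (W : WeierstrassCurve ℚ) (K : Type) [Field K] [NumberField K],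
      heegnerPointOfConductor_one_galoisConj N W K) :
    ∀ (W : WeierstrassCurve ℚ) [W.IsElliptic] [W.IsGloballyMinimal] [NeZero (W.conductorNorm ℤ)] (p : ℕ)
      [Fact p.Prime], Literature.NumberTheory.EllipticCurves.Rank1Residual.ClassX9 W p → W.analyticRank ≤ 1 →
      ¬ (∃ (q : ℕ) (_ : Fact q.Prime), q ∣ W.conductorNorm ℤ ∧ padicValNat p W.tamagawaProduct ≤
        padicValNat p ((W.baseChange ℚ_[q]).localTamagawaNumber ℤ_[q])) →
      ∃ B : ℕ, ∀ (K : Type) [Field K] [NumberField K]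
        (Dt : Literature.NumberTheory.EllipticCurves.ModularForms.ModularParametrizationData W (W.conductorNorm ℤ))
        (β : ℤ) (ι : K →+* ℂ), Literature.NumberTheory.EllipticCurves.IsImaginaryQuadratic K →
        B < (NumberField.discr K).natAbs →
        Literature.NumberTheory.EllipticCurves.SatisfiesHeegnerHypothesis (W.conductorNorm ℤ) K →
        Literature.NumberTheory.EllipticCurves.SatisfiesHeegnerHypothesis p K →
        (Odd (NumberField.discr K) ∧ ¬ p ∣ NumberField.classNumber K) →
        (4 * (W.conductorNorm ℤ : ℤ)) ∣ β ^ 2 - NumberField.discr K → ¬ (p : ℤ) ∣ Dt.c →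
        ∀ (d₁ : Literature.NumberTheory.EllipticCurves.KolyvaginHeegnerData Dt β ι 1),
          ¬ IsOfFinAddOrder d₁.derivedPoint →
        ∀ (s : ℕ), s ≤ padicValNat p W.tamagawaProduct →
        ∀ (n : ℕ) (d : Literature.NumberTheory.EllipticCurves.KolyvaginHeegnerData Dt β ι n), Squarefree n →
          (∀ ℓ ∈ n.primeFactors,
            Literature.NumberTheory.EllipticCurves.Zhang2014.IsKolyvaginPrime (W.conductorNorm ℤ) W K p ℓ ∧
              s ≤ Literature.NumberTheory.EllipticCurves.Zhang2014.kolyvaginIndex W p ℓ) →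
          ∃ Q : (W.baseChange (Literature.NumberTheory.EllipticCurves.ringClassField K ι n)).toAffine.Point,
            ((p ^ s : ℕ) : ℤ) • Q = d.derivedPoint := by
  intro W _ _ _ p _ hX9 _ _
  refine ⟨4, ?_⟩
  intro K _ _ Dt β ι hK hBK hHN hHp hfr hβ hc d₁ hd₁ s hs n d hn hℓ
  obtain ⟨hodd, hhK⟩ := hfr
  have hpP : p.Prime := Fact.out
  have hp2 : p ≠ 2 := hX9.ne_two
  have hneg : NumberField.discr K < 0 := IsImaginaryQuadratic.discr_neg hK
  have hlt : NumberField.discr K < -4 := by omega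
  have h3 : NumberField.discr K ≠ -3 := by omega
  have h4 : NumberField.discr K ≠ -4 := by omega
  have hpd : ¬ (p : ℤ) ∣ NumberField.discr K :=
    Literature.SatisfiesHeegnerHypothesis.not_dvd_discr hK.1 hHp hpP (dvd_refl p)
  have hpN : ¬ p ∣ W.conductorNorm ℤ := fun h ↦
    (W.dvd_conductorNorm_iff_not_hasGoodReductionAtPrime p).mp h hX9.good
  have hpN2 : ¬ p ^ 2 ∣ W.conductorNorm ℤ := fun h ↦ hpN (dvd_trans (dvd_pow_self p two_ne_zero) h)
  -- depth `0` is trivial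
  rcases Nat.eq_zero_or_pos s with rfl | hs1
  · exact ⟨d.derivedPoint, by rw [pow_zero, Nat.cast_one, one_zsmul]⟩
  -- the oriented Heegner datum of the frame and THE Heegner point `y_K ∈ E(K)`
  obtain ⟨H, hHβ⟩ := exists_heegnerDatum (W.conductorNorm ℤ) hneg hβ
  obtain ⟨P, hP⟩ := heegnerPointComplex_mem_range_map_holds (W.conductorNorm ℤ) W K hK hHN Dt H ι
  have hPd : d₁.toGeomPoints d₁.derivedPoint = toGeomPoints (W.baseChange K) P :=
    toGeomPoints_derivedPoint_one_eq (hrec _ W K) hK hHN hP d₁ hHβ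
  have hPinf : ¬ IsOfFinAddOrder P := fun hfin ↦
    hd₁ ((isOfFinAddOrder_derivedPoint_one_iff (hrec _ W K) hK hHN hP d₁ hHβ).mpr hfin)
  -- the identity over `K` at this frame (Howard road, intrinsic form)
  have hid := X9.indexIdentityAt_of_heegnerPoint_of_cor46_of_thm331 h46 hYZ h331 W p hX9 K (hKo _ W K)
    hK hodd hlt hHN hHp hhK Dt H ι P hP hPinf hc
  -- rank one and finiteness over `K` (Kolyvagin), no `p`-torsion (irreducibility)
  obtain ⟨hrank, hshaK⟩ := hKo (W.conductorNorm ℤ) W K hK hHN ⟨Dt, H, ι, hP⟩ hPinf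
  haveI : Finite (W.baseChange K).sha := hshaK
  haveI hfinp : Finite (AddCommGroup.primaryComponent (W.baseChange K).sha p) :=
    Finite.of_injective _ Subtype.val_injective
  have hbot := torsionBy_eq_bot_of_isImaginaryQuadratic_of_hasIrreducibleModPGaloisRep W K hK hpP hX9.irr
  have hiv : ∀ x : (W.baseChange K).toAffine.Point, p • x = 0 → x = 0 := fun x hx ↦ by
    have hmem : x ∈ AddSubgroup.torsionBy (W.baseChange K).toAffine.Point ((p : ℕ) : ℤ) := by
      rw [mem_torsionBy_iff, natCast_zsmul]
      exact hx
    rw [hbot] at hmem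
    exact hmem
  -- the exponent `p^{M₀} ∥ y_K` in `E(K)` and `ord_p [E(K):ℤy_K] = M₀` (McCallum Lemma 5.1)
  haveI : Module.Finite ℤ (W.baseChange K).toAffine.Point := (W.baseChange K).module_finite_point_holds
  obtain ⟨M₀, x₀, hx₀, hmax⟩ := exists_pow_smul_eq_and_forall_ne hPinf (p := p) hpP.two_le
  have hdiv : ∃ Q : (W.baseChange K).toAffine.Point, ((p ^ M₀ : ℕ) : ℤ) • Q = P :=
    ⟨x₀, by rw [natCast_zsmul]; exact hx₀⟩
  have hndiv : ¬ ∃ Q : (W.baseChange K).toAffine.Point, ((p ^ (M₀ + 1) : ℕ) : ℤ) • Q = P := by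
    rintro ⟨Q, hQ⟩
    exact hmax Q (by rw [← natCast_zsmul]; exact hQ)
  haveI : Finite (AddCommGroup.torsion (W.baseChange K).toAffine.Point) :=
    WeierstrassCurve.finite_torsion_point (W := W.baseChange K)
  obtain ⟨c, Q, hcQ, hcker⟩ := X11b.RankOne.exists_coord_of_mordellWeilRank_eq_one (W.baseChange K) hrank
  have hidx : padicValNat p (AddSubgroup.zmultiples P).index = M₀ :=
    padicValNat_index_zmultiples_eq_of_divisibility c Q hcQ hcker hiv P hdiv hndiv
  -- suppose `P_n ∉ p^s E(K_n)`: a level-`s` certificate; Cha's LOWER half bounds `#Ш` from below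
  by_contra hQ
  have hcert := hChaL W hX9.not_hasCM K hK h3 h4 hHN p hp2 hpd hpN2 hX9.irr Dt β ι d₁ P hPd hPinf M₀
    hdiv hndiv n (s - 1) d hn
    (fun ℓ hℓ' ↦ ⟨(hℓ ℓ hℓ').1, by have := (hℓ ℓ hℓ').2; omega⟩)
    (by rw [Nat.sub_add_cancel hs1]; exact hQ)
  have hle : 2 * (M₀ - (s - 1)) ≤
      padicValNat p (Nat.card (AddCommGroup.primaryComponent (W.baseChange K).sha p)) :=
    (padicValNat_dvd_iff_le Nat.card_pos.ne').mp hcert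
  rw [padicValNat_card_addPrimaryComponent (A := (W.baseChange K).sha) p] at hle
  -- the identity: `2t + ord_p #Ш(E/K) = 2M₀`
  unfold X11b.IndexIdentityAt at hid
  rw [WeierstrassCurve.shaOrder, hidx] at hid
  omega

end Summit.BirchSwinnertonDyer.BirchSwinnertonDyer.Rank1Residual

end
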